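import Summits.HodgeConjecture.CorCM.MumfordTateRankCurveTimesSurface
import Summits.HodgeConjecture.CorCM.MumfordTateRankOfPowers
import Literature.Algebra.Lie.SemisimpleDimensionTen
import HarnessLib

/-!
# The Mumford–Tate rank of a product of two SIMPLE SURFACES: the cells `6, 9, 13` (CM × non-CM), `7` (QM × QM′), `10` (QM × RM),
# `14` (QM × `End⁰ = ℚ`), `17` (RM × `End⁰ = ℚ`), and the isogenous diagonal `3, 4, 7, 11`

COR-CM (cell `pub-hodgecm2`, seat `b27` gen 47, count-neutral Mumford–Tate-rank ladder; theorems only, no definition, no named fact;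
UNCONDITIONAL — nothing here uses or asserts HC_CM).  For `X ∼ S × S′` with SIMPLE complex abelian surfaces `S, S′` (types: CM `t = 3`,
QM `t = 4`, RM `t = 7`, `End⁰ = ℚ` `t = 11`, `CorCM/MumfordTateRankSimpleSurfacesSharp`):

| `S` \\ `S′`   | CM    | QM    | RM     | `ℚ`    |
|---------------|-------|-------|--------|--------|
| CM            | (≤ 5) | `6`   | `9`    | `13`   |
| QM            |       | `7`∗  | `10`   | `14`   |
| RM            |       |       | (≤ 13) | **`17`** |
| `ℚ`           |       |       |        | (≤ 21) |

(∗ non-isogenous; `S ∼ S′` gives `t(X) = t(S)`.)  Row CM: Moonen–Zarhin Thm. (3.2)(2).  `7`: `CorCM/MumfordTateRankSevenSplitConverse`.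
`10, 14, 17`: the product theorem for `Θ`-rigid factors (`CorCM/MumfordTateRankProductRigidFactors`): `Lie Hg(H¹(QM)) ≅ 𝔰𝔩₁(D)` simple of
dimension `3`, `Lie Hg(H¹(RM)) = Res_{K/ℚ} 𝔰𝔩₂` simple of dimension `6`, `Lie Hg(H¹(S_ℚ)) = 𝔰𝔭₄` semisimple of dimension `10`; the
dimension gaps `3 ≠ 6`, `10 − 3 = 7`, `10 − 6 = 4` exclude the graph case of Goursat's lemma.  The diagonal cells RM × RM′, `ℚ × ℚ′`
(equal dimensions) and CM × CM′ are bounded here only by subadditivity.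

## References
* [MoonenZarhin1999LowDim] B. Moonen, Yu. G. Zarhin, Math. Ann. 315 (1999), §2 (2.2), §3 (3.1)–(3.2), §5 (products of surfaces).
  [cite: MoonenZarhin1999LowDim, §3 (3.1) and Thm. (3.2)(2)]
* [Hazama1983] F. Hazama, Tôhoku Math. J. 35 (1983), Lemma (3.1). [cite: Hazama1983, Lemma (3.1)]
-/

noncomputable section

open scoped TensorProduct
open CategoryTheory CategoryTheory.Limits Module

namespace Summit.HodgeConjecture.CorCM

open Literature.AlgebraicGeometry.Motives
open Literature.AlgebraicGeometry.Motives.AbelianVariety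
open Literature.AlgebraicGeometry.Motives.HodgeStructure
open Literature.AlgebraicGeometry.HodgeTheory
open Literature.AlgebraicGeometry.Milne1999 (IsOfCMType)

variable [HodgeTensorFacts.{0, 0}] {X : AbelianVariety ℂ} {n : ℕ}

/-- Facts about a simple QM surface (`dim_ℚ End⁰S = 4`, not CM): `t = 4`, no factor of type IV, `dim End⁰ = (dim S)²`, centre `ℚ`.
[cite: MoonenZarhin1999LowDim, §2 (2.2)] -/
theorem qmSurface_facts {S : AbelianVariety ℂ} (hSs : S.IsSimple) (hS2 : S.dim = 2) (hSE : Module.finrank ℚ S.endAlgebra = 4)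
    (hScm : ¬ IsOfCMType S) :
    haveI := BettiUniverse.finite (AbelianVariety.isSmoothProjective_holds (A := S)) 1
    (BettiUniverse.hodge exists_isReal_hodgeModel_holds (AbelianVariety.isSmoothProjective_holds (A := S)) 1).mtRank = 4 ∧
      HasNoTypeIVFactor S ∧ Module.finrank ℚ S.endAlgebra = S.dim ^ 2 ∧ Module.finrank ℚ (Subalgebra.center ℚ S.endAlgebra) = 1 := by
  classical
  have hS : IsSmoothProjective S.dim S.X := AbelianVariety.isSmoothProjective_holds
  haveI := BettiUniverse.finite hS 1
  have hS0 : 0 < S.dim := by omega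
  have h4 : (BettiUniverse.hodge exists_isReal_hodgeModel_holds hS 1).mtRank = 4 := by
    rcases mtRank_hodge_one_of_isSimple_surface_sharp hS hSs hS2 with ⟨h1, -⟩ | ⟨h2, -⟩ | ⟨-, -, hcm', -⟩ | ⟨-, -, h⟩
    · omega
    · omega
    · exact absurd hcm' hScm
    · exact h
  have hZ := center_endAlgebra_eq_bot_of_not_isOfCMType hS hS0 hScm h4.le
  haveI : Nontrivial S.endAlgebra := Literature.AlgebraicGeometry.ComplexMultiplication.nontrivial_endAlgebra_of_dim_pos hS0
  exact ⟨h4, hasNoTypeIVFactor_of_isSimple_surface_of_not_isOfCMType hSs hS2 hScm, by rw [hSE, hS2]; rfl,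
    by rw [hZ, Subalgebra.finrank_bot]⟩

/-- **`Lie Hg(H¹S)` is a SIMPLE Lie algebra for an abelian SURFACE with `End⁰S = ℚ`** (`Lie Hg = 𝔰𝔭₄`: semisimple — no factor of type IV —
of dimension `10`, and a `10`-dimensional semisimple Lie algebra is simple, `SemisimpleDimensionTen`). [cite: MoonenZarhin1999LowDim, §2 (2.2)]
[cite: Humphreys1972, §5.2] -/
theorem isSimple_hodgeLie_hodge_one_of_surface_of_finrank_endAlgebra_eq_one (hX : IsSmoothProjective n X.X) (hX2 : X.dim = 2)
    (hE1 : Module.finrank ℚ X.endAlgebra = 1) :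
    haveI := BettiUniverse.finite hX 1
    letI : LieRing (Module.End ℚ (bettiCohomology X.X 1)) := LieRing.ofAssociativeRing
    ∀ 𝔏 : LieSubalgebra ℚ (Module.End ℚ (bettiCohomology X.X 1)),
      𝔏.toSubmodule = (BettiUniverse.hodge exists_isReal_hodgeModel_holds hX 1).hodgeLie → LieAlgebra.IsSimple ℚ 𝔏 := by
  haveI := BettiUniverse.finite hX 1
  letI : LieRing (Module.End ℚ (bettiCohomology X.X 1)) := LieRing.ofAssociativeRing
  intro 𝔏 h𝔏
  haveI : LieAlgebra.IsSemisimple ℚ 𝔏 :=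
    (isSemisimple_of_eq_hodgeLie_hodge_one_of_hasNoTypeIVFactor hX (hasNoTypeIVFactor_of_finrank_endAlgebra_eq_one hE1) 𝔏 h𝔏).1
  haveI : Module.Finite ℚ 𝔏 := Module.Finite.of_injective 𝔏.toSubmodule.subtype Subtype.val_injective
  have h10 : Module.finrank ℚ 𝔏 = 10 := by
    have e : Module.finrank ℚ 𝔏 = Module.finrank ℚ (BettiUniverse.hodge exists_isReal_hodgeModel_holds hX 1).hodgeLie := by
      rw [← h𝔏]; rfl
    rw [e]; exact (mtRank_hodge_one_eq_eleven_of_surface_of_finrank_endAlgebra_eq_one hX hX2 hE1).2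
  exact Literature.Algebra.Lie.SemisimpleSmallDimension.isSimple_of_finrank_eq_ten h10

/-! ## §1 The isogenous diagonal and the CM row -/

/-- **`S ∼ S′` simple surfaces: `t(S × S′) = t(S) ∈ {3, 4, 7, 11}`** (`X ∼ S²`). [cite: MoonenZarhin1999LowDim, §1 and §2 (2.2)] -/
theorem mtRank_hodge_one_of_isIsogenous_prod_isogenous_surfaces (hX : IsSmoothProjective n X.X) {S S' : AbelianVariety ℂ}
    (hSs : S.IsSimple) (hS2 : S.dim = 2) (hSS' : IsIsogenous S S') (hXP : IsIsogenous X (S.prod S')) :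
    haveI := BettiUniverse.finite hX 1
    (BettiUniverse.hodge exists_isReal_hodgeModel_holds hX 1).mtRank = 3 ∨ (BettiUniverse.hodge exists_isReal_hodgeModel_holds hX 1).mtRank = 4 ∨
      (BettiUniverse.hodge exists_isReal_hodgeModel_holds hX 1).mtRank = 7 ∨ (BettiUniverse.hodge exists_isReal_hodgeModel_holds hX 1).mtRank = 11 := by
  have hS : IsSmoothProjective S.dim S.X := AbelianVariety.isSmoothProjective_holds
  haveI := BettiUniverse.finite hX 1
  haveI := BettiUniverse.finite hS 1
  have h := mtRank_hodge_one_eq_of_isIsogenous_powSucc hX hS (by omega) (m := 1) (hXP.trans ((IsIsogenous.refl S).prod hSS'.symm'))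
  rw [h]
  exact mtRank_hodge_one_mem_of_isSimple_surface hS hSs hS2

/-- **CM simple surface × simple non-CM surface: `t = t(S′) + 2 ∈ {6, 9, 13}`** (QM `6`, RM `9`, `End⁰ = ℚ` `13`; `t + 1 = t(S′) + 3`,
`S′` has no factor of type IV). [cite: MoonenZarhin1999LowDim, §2 (2.2) and §3 Thm. (3.2)(2)] -/
theorem mtRank_hodge_one_of_isIsogenous_cmSurface_prod_isSimple_surface (hX : IsSmoothProjective n X.X) {S S' : AbelianVariety ℂ}
    (hSs : S.IsSimple) (hS2 : S.dim = 2) (hScm : IsOfCMType S) (hS's : S'.IsSimple) (hS'2 : S'.dim = 2) (hS'cm : ¬ IsOfCMType S')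
    (hXP : IsIsogenous X (S.prod S')) :
    haveI := BettiUniverse.finite hX 1
    (Module.finrank ℚ S'.endAlgebra = 4 ∧ (BettiUniverse.hodge exists_isReal_hodgeModel_holds hX 1).mtRank = 6) ∨
      (Module.finrank ℚ S'.endAlgebra = 2 ∧ (BettiUniverse.hodge exists_isReal_hodgeModel_holds hX 1).mtRank = 9) ∨
      (Module.finrank ℚ S'.endAlgebra = 1 ∧ (BettiUniverse.hodge exists_isReal_hodgeModel_holds hX 1).mtRank = 13) := by
  have hS : IsSmoothProjective S.dim S.X := AbelianVariety.isSmoothProjective_holds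
  have hS' : IsSmoothProjective S'.dim S'.X := AbelianVariety.isSmoothProjective_holds
  haveI := BettiUniverse.finite hX 1
  haveI := BettiUniverse.finite hS 1
  haveI := BettiUniverse.finite hS' 1
  have h3 := (isOfCMType_iff_mtRank_hodge_one_eq_three_of_isSimple_surface hS hSs hS2).1 hScm
  have hA4 : HasNoTypeIVFactor S' := hasNoTypeIVFactor_of_isSimple_surface_of_not_isOfCMType hS's hS'2 hS'cm
  have h := mtRank_hodge_one_add_one_eq_add_of_isIsogenous_prod hX hS' hS (by omega) (by omega) hA4 hScm
    (hXP.trans (isIsogenous_prod_comm S S'))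
  rcases mtRank_hodge_one_of_isSimple_surface_sharp hS' hS's hS'2 with ⟨h1, h11⟩ | ⟨h2, h7⟩ | ⟨-, -, hcm', -⟩ | ⟨h4, -, h4'⟩
  · exact Or.inr (Or.inr ⟨h1, by omega⟩)
  · exact Or.inr (Or.inl ⟨h2, by omega⟩)
  · exact absurd hcm' hS'cm
  · exact Or.inl ⟨h4, by omega⟩

/-- **Two simple CM surfaces: `t ≤ 5`** (subadditivity `t + 1 ≤ 3 + 3`). [cite: MoonenZarhin1999LowDim, §3 (3.1)] -/
theorem mtRank_hodge_one_le_five_of_isIsogenous_prod_cmSurfaces (hX : IsSmoothProjective n X.X) {S S' : AbelianVariety ℂ}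
    (hSs : S.IsSimple) (hS2 : S.dim = 2) (hScm : IsOfCMType S) (hS's : S'.IsSimple) (hS'2 : S'.dim = 2) (hS'cm : IsOfCMType S')
    (hXP : IsIsogenous X (S.prod S')) :
    haveI := BettiUniverse.finite hX 1
    (BettiUniverse.hodge exists_isReal_hodgeModel_holds hX 1).mtRank ≤ 5 := by
  have hS : IsSmoothProjective S.dim S.X := AbelianVariety.isSmoothProjective_holds
  have hS' : IsSmoothProjective S'.dim S'.X := AbelianVariety.isSmoothProjective_holds
  haveI := BettiUniverse.finite hX 1
  haveI := BettiUniverse.finite hS 1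
  haveI := BettiUniverse.finite hS' 1
  have h3 := (isOfCMType_iff_mtRank_hodge_one_eq_three_of_isSimple_surface hS hSs hS2).1 hScm
  have h3' := (isOfCMType_iff_mtRank_hodge_one_eq_three_of_isSimple_surface hS' hS's hS'2).1 hS'cm
  have h := mtRank_hodge_one_add_one_le_add_of_isIsogenous_prod hS hS' (by omega) (by omega) hX hXP
  omega

/-! ## §2 The QM row: `7`, `10`, `14` -/

/-- **Two NON-isogenous simple QM surfaces: `t = 7`** (`Hg = SL₁(D) × SL₁(D′)`). [cite: MoonenZarhin1999LowDim, §3 (3.1)] -/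
theorem mtRank_hodge_one_eq_seven_of_isIsogenous_prod_qmSurfaces (hX : IsSmoothProjective n X.X) {S S' : AbelianVariety ℂ}
    (hSs : S.IsSimple) (hS2 : S.dim = 2) (hSE : Module.finrank ℚ S.endAlgebra = 4) (hScm : ¬ IsOfCMType S)
    (hS's : S'.IsSimple) (hS'2 : S'.dim = 2) (hS'E : Module.finrank ℚ S'.endAlgebra = 4) (hS'cm : ¬ IsOfCMType S')
    (hSS' : ¬ IsIsogenous S S') (hXP : IsIsogenous X (S.prod S')) :
    haveI := BettiUniverse.finite hX 1
    (BettiUniverse.hodge exists_isReal_hodgeModel_holds hX 1).mtRank = 7 := by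
  haveI := BettiUniverse.finite hX 1
  obtain ⟨-, -, hsq, hz⟩ := qmSurface_facts hSs hS2 hSE hScm
  obtain ⟨-, -, hsq', hz'⟩ := qmSurface_facts hS's hS'2 hS'E hS'cm
  exact (mtRank_hodge_one_eq_seven_of_isIsogenous_powSucc_prod_powSucc hX hSs hS's (by omega) (by omega) (by omega) (by omega)
    hScm hS'cm hsq hz hsq' hz' hSS' (a := 0) (b := 0) hXP).1

/-- **Simple QM surface × simple RM surface: `t = 10`** (`t + 1 = 4 + 7`; `Θ`-rigid factors with simple Hodge Lie algebras of dimensions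
`3 ≠ 6`). [cite: MoonenZarhin1999LowDim, §3 (3.1)] [cite: Hazama1983, Lemma (3.1)] -/
theorem mtRank_hodge_one_eq_ten_of_isIsogenous_qmSurface_prod_rmSurface (hX : IsSmoothProjective n X.X) {S S' : AbelianVariety ℂ}
    (hSs : S.IsSimple) (hS2 : S.dim = 2) (hSE : Module.finrank ℚ S.endAlgebra = 4) (hScm : ¬ IsOfCMType S)
    (hS's : S'.IsSimple) (hS'2 : S'.dim = 2) (hS'E : Module.finrank ℚ S'.endAlgebra = 2) (hXP : IsIsogenous X (S.prod S')) :
    haveI := BettiUniverse.finite hX 1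
    (BettiUniverse.hodge exists_isReal_hodgeModel_holds hX 1).mtRank = 10 := by
  have hS : IsSmoothProjective S.dim S.X := AbelianVariety.isSmoothProjective_holds
  have hS' : IsSmoothProjective S'.dim S'.X := AbelianVariety.isSmoothProjective_holds
  haveI := BettiUniverse.finite hX 1
  haveI := BettiUniverse.finite hS 1
  haveI := BettiUniverse.finite hS' 1
  obtain ⟨h4, hA4, -, -⟩ := qmSurface_facts hSs hS2 hSE hScm
  obtain ⟨h7, -, -, -, -⟩ := mtRank_hodge_one_eq_seven_of_isIsogenous_powSucc_rmSurface hS' hS's hS'2 hS'E (m := 0) (IsIsogenous.refl S')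
  have hfS := mtRank_hodge_one_eq_finrank_hodgeLie_add_one hS (by omega)
  have hfS' := mtRank_hodge_one_eq_finrank_hodgeLie_add_one hS' (by omega)
  have h := mtRank_hodge_one_add_one_eq_add_of_isIsogenous_prod_of_rigid hX hS hS' (by omega) (by omega)
    (hodgeLie_rigid_of_not_isOfCMType_of_mtRank_le_four hS (by omega) hScm h4.le)
    (hodgeLie_rigid_of_isSimple_surface_of_finrank_endAlgebra_eq_two hS' hS's hS'2 hS'E)
    (isSimple_hodgeLie_hodge_one_of_hasNoTypeIVFactor_of_mtRank_eq_four hS (by omega) hA4 h4)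
    (Or.inl ⟨isSimple_hodgeLie_of_isIsogenous_powSucc_rmSurface hS' hS's hS'2 hS'E (m := 0) (IsIsogenous.refl S'), by omega⟩) hXP
  omega

/-- **Simple QM surface × surface with `End⁰ = ℚ`: `t = 14`** (`t + 1 = 4 + 11`; dimensions `3` and `10 = 3 + 7`).
[cite: MoonenZarhin1999LowDim, §3 (3.1)] [cite: Hazama1983, Lemma (3.1)] -/
theorem mtRank_hodge_one_eq_fourteen_of_isIsogenous_qmSurface_prod_surface_endRankOne (hX : IsSmoothProjective n X.X)
    {S S' : AbelianVariety ℂ} (hSs : S.IsSimple) (hS2 : S.dim = 2) (hSE : Module.finrank ℚ S.endAlgebra = 4) (hScm : ¬ IsOfCMType S)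
    (hS'2 : S'.dim = 2) (hS'E : Module.finrank ℚ S'.endAlgebra = 1) (hXP : IsIsogenous X (S.prod S')) :
    haveI := BettiUniverse.finite hX 1
    (BettiUniverse.hodge exists_isReal_hodgeModel_holds hX 1).mtRank = 14 := by
  have hS : IsSmoothProjective S.dim S.X := AbelianVariety.isSmoothProjective_holds
  have hS' : IsSmoothProjective S'.dim S'.X := AbelianVariety.isSmoothProjective_holds
  haveI := BettiUniverse.finite hX 1
  haveI := BettiUniverse.finite hS 1
  haveI := BettiUniverse.finite hS' 1
  obtain ⟨h4, hA4, -, -⟩ := qmSurface_facts hSs hS2 hSE hScm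
  obtain ⟨h11, h10⟩ := mtRank_hodge_one_eq_eleven_of_surface_of_finrank_endAlgebra_eq_one hS' hS'2 hS'E
  have hfS := mtRank_hodge_one_eq_finrank_hodgeLie_add_one hS (by omega)
  have hS'4 : HasNoTypeIVFactor S' := hasNoTypeIVFactor_of_finrank_endAlgebra_eq_one hS'E
  have h := mtRank_hodge_one_add_one_eq_add_of_isIsogenous_prod_of_rigid hX hS hS' (by omega) (by omega)
    (hodgeLie_rigid_of_not_isOfCMType_of_mtRank_le_four hS (by omega) hScm h4.le)
    (hodgeLie_rigid_of_surface_of_finrank_endAlgebra_eq_one hS' hS'2 hS'E)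
    (isSimple_hodgeLie_hodge_one_of_hasNoTypeIVFactor_of_mtRank_eq_four hS (by omega) hA4 h4)
    (Or.inr ⟨fun 𝔏 h𝔏 => (isSemisimple_of_eq_hodgeLie_hodge_one_of_hasNoTypeIVFactor hS' hS'4 𝔏 h𝔏).1, by omega⟩) hXP
  omega

/-! ## §3 RM × `End⁰ = ℚ`: `t = 17` -/

/-- **Simple RM surface × surface with `End⁰ = ℚ`: `t = 17`** (`Hg = R_{K/ℚ} SL₂ × Sp₄`, `t + 1 = 7 + 11`; `Θ`-rigid factors,
`Lie Hg(H¹S)` simple of dimension `6`, `Lie Hg(H¹S′) = 𝔰𝔭₄` semisimple of dimension `10 = 6 + 4`, and a semisimple Lie algebra has no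
ideal of dimension `4`). [cite: MoonenZarhin1999LowDim, §3 (3.1)] [cite: Hazama1983, Lemma (3.1)] -/
theorem mtRank_hodge_one_eq_seventeen_of_isIsogenous_rmSurface_prod_surface_endRankOne (hX : IsSmoothProjective n X.X)
    {S S' : AbelianVariety ℂ} (hSs : S.IsSimple) (hS2 : S.dim = 2) (hSE : Module.finrank ℚ S.endAlgebra = 2)
    (hS'2 : S'.dim = 2) (hS'E : Module.finrank ℚ S'.endAlgebra = 1) (hXP : IsIsogenous X (S.prod S')) :
    haveI := BettiUniverse.finite hX 1
    (BettiUniverse.hodge exists_isReal_hodgeModel_holds hX 1).mtRank = 17 := by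
  have hS : IsSmoothProjective S.dim S.X := AbelianVariety.isSmoothProjective_holds
  have hS' : IsSmoothProjective S'.dim S'.X := AbelianVariety.isSmoothProjective_holds
  haveI := BettiUniverse.finite hX 1
  haveI := BettiUniverse.finite hS 1
  haveI := BettiUniverse.finite hS' 1
  obtain ⟨h7, -, -, -, -⟩ := mtRank_hodge_one_eq_seven_of_isIsogenous_powSucc_rmSurface hS hSs hS2 hSE (m := 0) (IsIsogenous.refl S)
  obtain ⟨h11, h10⟩ := mtRank_hodge_one_eq_eleven_of_surface_of_finrank_endAlgebra_eq_one hS' hS'2 hS'E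
  have hfS := mtRank_hodge_one_eq_finrank_hodgeLie_add_one hS (by omega)
  have hS'4 : HasNoTypeIVFactor S' := hasNoTypeIVFactor_of_finrank_endAlgebra_eq_one hS'E
  have h := mtRank_hodge_one_add_one_eq_add_of_isIsogenous_prod_of_rigid hX hS hS' (by omega) (by omega)
    (hodgeLie_rigid_of_isSimple_surface_of_finrank_endAlgebra_eq_two hS hSs hS2 hSE)
    (hodgeLie_rigid_of_surface_of_finrank_endAlgebra_eq_one hS' hS'2 hS'E)
    (isSimple_hodgeLie_of_isIsogenous_powSucc_rmSurface hS hSs hS2 hSE (m := 0) (IsIsogenous.refl S))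
    (Or.inr ⟨fun 𝔏 h𝔏 => (isSemisimple_of_eq_hodgeLie_hodge_one_of_hasNoTypeIVFactor hS' hS'4 𝔏 h𝔏).1, by omega⟩) hXP
  omega

/-- **Upper bounds on the remaining diagonal cells**: RM × RM′ `t ≤ 13`, `ℚ × ℚ′` `t ≤ 21` (subadditivity; equality is expected for
non-isogenous factors — Goursat's graph case is not excluded here). [cite: MoonenZarhin1999LowDim, §3 (3.1)] -/
theorem mtRank_hodge_one_le_of_isIsogenous_prod_surfaces_rm_or_endRankOne (hX : IsSmoothProjective n X.X) {S S' : AbelianVariety ℂ}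
    (hSs : S.IsSimple) (hS2 : S.dim = 2) (hS's : S'.IsSimple) (hS'2 : S'.dim = 2) (hXP : IsIsogenous X (S.prod S')) :
    haveI := BettiUniverse.finite hX 1
    (Module.finrank ℚ S.endAlgebra = 2 → Module.finrank ℚ S'.endAlgebra = 2 → (BettiUniverse.hodge exists_isReal_hodgeModel_holds hX 1).mtRank ≤ 13) ∧
      (Module.finrank ℚ S.endAlgebra = 1 → Module.finrank ℚ S'.endAlgebra = 1 →
        (BettiUniverse.hodge exists_isReal_hodgeModel_holds hX 1).mtRank ≤ 21) := by
  have hS : IsSmoothProjective S.dim S.X := AbelianVariety.isSmoothProjective_holds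
  have hS' : IsSmoothProjective S'.dim S'.X := AbelianVariety.isSmoothProjective_holds
  haveI := BettiUniverse.finite hX 1
  haveI := BettiUniverse.finite hS 1
  haveI := BettiUniverse.finite hS' 1
  have h := mtRank_hodge_one_add_one_le_add_of_isIsogenous_prod hS hS' (by omega) (by omega) hX hXP
  obtain ⟨e11, e7⟩ := mtRank_hodge_one_eq_eleven_iff_and_eq_seven_iff_of_isSimple_surface hS hSs hS2
  obtain ⟨e11', e7'⟩ := mtRank_hodge_one_eq_eleven_iff_and_eq_seven_iff_of_isSimple_surface hS' hS's hS'2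
  refine ⟨fun h2 h2' => ?_, fun h1 h1' => ?_⟩
  · have := e7.2 h2; have := e7'.2 h2'; omega
  · have := e11.2 h1; have := e11'.2 h1'; omega

end Summit.HodgeConjecture.CorCM

end
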